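import Summits.Ventures.QEC.Census.CertTwoBlockShift
import Summits.Ventures.QEC.Census.CertBZPlaneSeg3
import HarnessLib

/-!
# The TWO-BLOCK SHIFT lane — engine glue for THIRD-ROW parts (`Plane.seg3OK`)

Venture QEC (cell `qec`), qec-type-01 gen 6 (census KERNEL-upgrade lane, director-qec R33; PARTITION item 133 «01.TBSHIFT»,
line «PARTITION v2.48 D50.L4 L-DEEP», nodes `A1s_n156_k4` / `A1s_n162_k4`, `d = 16`).

WHY. A forced-top-row family of the shift lane (`TopReaches`, `Census/CertTwoBlockShift.lean`) is replayed either as ONE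
plain segment (`Plane.topReaches_of_seg`) or as the singleton plus second-row ranges (`Plane.topReaches_of_seg2`). At
`wmax = 15` (`t = 7` light points, `≤ 6` further light rows) a SINGLE second row `p` already carries `Σ_{w ≤ 5} C(p, w)`
lanes — `9.7·10⁶` for `p = 66` (`[[156,4,16]]`), `1.3·10⁷` for `p = 70` (`[[162,4,16]]`) — more than one `decide +kernel`
declaration holds (kernel memory; measured family cap `≈ 10⁹ / n` lanes). This file adds the glue for ONE more level, on
qec-type-10's third-row families (`Census/CertBZPlaneSeg3.lean`: `Plane.seg3Family`, `Plane.seg3OK`, `Plane.covers_seg3`):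
**`Plane.topReaches_of_seg3`** — the singleton of the forced row passes; every second row `p < |G|` lies in a listed
second-row range passing `seg2OK … (t+1) |G| p₀ q` OR is listed in `dbl`; for every `p ∈ dbl` the bare pair `{p, |G|}`
passes (`seg2OK … 2 |G| p 1`) and every third row `r < p` lies in a listed third-row range passing
`seg3OK … (t+1) |G| p r₀ q` ⇒ `TopReaches (bzLeaf wmax allow) G g t`. One theorem + a control; no definitions.
HONEST FRAMING: infrastructure; no certificate is read and no distance is asserted here. Tier KERNEL, axioms standard,
no `native_decide`. [folklore]
-/

set_option autoImplicit false

namespace Summit.Ventures.QEC.Census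

open List

namespace Plane

/-- **Glue (second- and third-row parts).** If the rows of `G ++ [g]` are words below `2^n`, the singleton family of the
forced row `|G|` passes (`segOK … 1 |G| 1`), every `p < |G|` lies in some listed range `(p₀, q)` whose second-row family
passes `seg2OK n wmax allow (G ++ [g]) (t+1) |G| p₀ q fuel` OR is listed in `dbl`, every `p ∈ dbl` passes as the bare pair
(`seg2OK … 2 |G| p 1`) and has every `r < p` in some listed third-row range `(p, r₀, q)` passing
`seg3OK n wmax allow (G ++ [g]) (t+1) |G| p r₀ q fuel` (selections `S ∪ {r, p, |G|}`, `|S| ≤ t − 2`), then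
`TopReaches (bzLeaf wmax allow) G g t`. -/
theorem topReaches_of_seg3 (n wmax : ℕ) (allow G : List ℕ) (g : ℕ) (t fuel : ℕ) (hG : ∀ x ∈ G ++ [g], x < 2 ^ n)
    (hsing : segOK n wmax allow (G ++ [g]) 1 G.length 1 fuel = true)
    (ranges : List (ℕ × ℕ)) (dbl : List ℕ)
    (hcov : ((List.range G.length).all fun p =>
      (ranges.any fun r => decide (r.1 ≤ p) && decide (p < r.1 + r.2)) || dbl.elem p) = true)
    (hpairs : ∀ r ∈ ranges, seg2OK n wmax allow (G ++ [g]) (t + 1) G.length r.1 r.2 fuel = true)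
    (hdbl : ∀ p ∈ dbl, seg2OK n wmax allow (G ++ [g]) 2 G.length p 1 fuel = true)
    (triples : List (ℕ × ℕ × ℕ))
    (htcov : (dbl.all fun p => (List.range p).all fun r =>
      triples.any fun x => decide (x.1 = p) && decide (x.2.1 ≤ r) && decide (r < x.2.1 + x.2.2)) = true)
    (htriples : ∀ x ∈ triples, seg3OK n wmax allow (G ++ [g]) (t + 1) G.length x.1 x.2.1 x.2.2 fuel = true) :
    TopReaches (bzLeaf wmax allow) G g t := by
  refine topReaches_of_cover _ G g t fun J hJp hJlt hJl => ?_
  have hJp' : (J ++ [G.length]).Pairwise (· < ·) := by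
    rw [List.pairwise_append]
    exact ⟨hJp, List.pairwise_singleton _ _, fun j hj m hm => by
      rw [List.mem_singleton] at hm; subst hm; exact hJlt j hj⟩
  have hJlt' : ∀ j ∈ J ++ [G.length], j < (G ++ [g]).length := fun j hj => by
    rw [List.length_append, List.length_singleton]
    rcases List.mem_append.1 hj with h | h
    · have := hJlt j h; omega
    · rw [List.mem_singleton] at h; omega
  rcases List.eq_nil_or_concat J with rfl | ⟨J', p, rfl⟩
  · -- the forced row alone
    rw [segOK] at hsing
    obtain ⟨b, hb, hbits⟩ := covers_segment 1 G.length 1 (le_refl _) (by omega) [] List.Pairwise.nil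
      (fun _ h => by simp at h) (by simp)
    exact leaf_of_familyOK_covers n wmax allow (G ++ [g]) fuel hG _ hsing _ hJp' hJlt' hb hbits
  · -- a second-largest row `p < |G|`
    rw [List.concat_eq_append] at hJp hJlt hJl hJp' hJlt' ⊢
    have hpG : p < G.length := hJlt p (by simp)
    have hJ'p : J'.Pairwise (· < ·) := (List.pairwise_append.1 hJp).1
    have hJ'lt : ∀ j ∈ J', j < p := fun j hj => (List.pairwise_append.1 hJp).2.2 j hj p (List.mem_singleton_self p)
    have hJ'l : J'.length ≤ t + 1 - 2 := by
      rw [List.length_append, List.length_singleton] at hJl; omega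
    simp only [List.all_eq_true, List.mem_range, Bool.or_eq_true, List.any_eq_true, Bool.and_eq_true,
      decide_eq_true_eq] at hcov
    rcases hcov p hpG with ⟨r, hr, h1, h2⟩ | hdb
    · -- a listed second-row range
      obtain ⟨b, hb, hbits⟩ := covers_seg2 (t + 1) G.length r.1 r.2 h1 h2 hpG J' hJ'p hJ'lt hJ'l
      have hok := hpairs r hr
      rw [seg2OK] at hok
      exact leaf_of_familyOK_covers n wmax allow (G ++ [g]) fuel hG _ hok _ hJp' hJlt' hb hbits
    · -- a doubled second row: split by the third-largest row
      have hpmem : p ∈ dbl := List.mem_of_elem_eq_true hdb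
      rcases List.eq_nil_or_concat J' with hJ'0 | ⟨J'', r, hJ'e⟩
      · -- the bare pair `{p, |G|}`
        subst hJ'0
        have hok := hdbl p hpmem
        rw [seg2OK] at hok
        obtain ⟨b, hb, hbits⟩ := covers_seg2 2 G.length p 1 (le_refl p) (by omega) hpG [] List.Pairwise.nil
          (fun _ h => by simp at h) (by simp)
        exact leaf_of_familyOK_covers n wmax allow (G ++ [g]) fuel hG _ hok _ hJp' hJlt' hb hbits
      · subst hJ'e
        rw [List.concat_eq_append] at hJ'p hJ'lt hJp hJlt hJl hJp' hJlt' ⊢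
        have hrp : r < p := hJ'lt r (by simp)
        have hJ''p : J''.Pairwise (· < ·) := (List.pairwise_append.1 hJ'p).1
        have hJ''lt : ∀ j ∈ J'', j < r := fun j hj =>
          (List.pairwise_append.1 hJ'p).2.2 j hj r (List.mem_singleton_self r)
        have hJ''l : J''.length ≤ t + 1 - 3 := by
          simp only [List.length_append, List.length_singleton] at hJl; omega
        simp only [List.all_eq_true, List.mem_range, List.any_eq_true, Bool.and_eq_true, decide_eq_true_eq] at htcov
        obtain ⟨x, hx, ⟨hx1, h1⟩, h2⟩ := htcov p hpmem r hrp
        obtain ⟨b, hb, hbits⟩ := covers_seg3 (t + 1) G.length p x.2.1 x.2.2 h1 h2 hrp hpG J'' hJ''p hJ''lt hJ''l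
        have hok := htriples x hx
        rw [seg3OK, hx1] at hok
        exact leaf_of_familyOK_covers n wmax allow (G ++ [g]) fuel hG _ hok _ hJp' hJlt' hb hbits

end Plane

/-! ## Control (tier KERNEL, `decide`) -/

/-- The Steane matrix of `Census/CertBZPlane.lean` with its last row forced, budget `2` further rows: second row `0` by the
range `(0, 1)`, second rows `1, 2` DOUBLED (bare pairs + third-row ranges `(1, 0, 1)`, `(2, 0, 2)`) — every selection of
`≤ 2` of the first three rows XOR-ed onto row `3` has weight `≥ 3`; and `seg3OK` on its own, to keep the statement new. -/
theorem topReaches_steane_seg3 :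
    TopReaches (bzLeaf 2 []) (Plane.steaneG.take 3) (Plane.steaneG.getD 3 0) 2 ∧
      Plane.seg3OK 7 2 [] (Plane.steaneG.take 3 ++ [Plane.steaneG.getD 3 0]) 3 3 2 0 2 1 = true :=
  ⟨Plane.topReaches_of_seg3 7 2 [] (Plane.steaneG.take 3) (Plane.steaneG.getD 3 0) 2 1 (by decide) (by decide)
      [(0, 1)] [1, 2] (by decide)
      (by intro r hr; simp only [List.mem_singleton] at hr; subst hr; decide)
      (by intro p hp; simp only [List.mem_cons, List.not_mem_nil, or_false] at hp; rcases hp with rfl | rfl <;> decide)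
      [(1, 0, 1), (2, 0, 2)] (by decide)
      (by intro x hx; simp only [List.mem_cons, List.not_mem_nil, or_false] at hx; rcases hx with rfl | rfl <;> decide),
    by decide⟩

end Summit.Ventures.QEC.Census
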